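import Summits.MatrixMultiplication.MatrixMultiplication.Theorems.SoloInformedCwTwoValueWeights
import Summits.MatrixMultiplication.MatrixMultiplication.Theorems.SoloInformedCwTwoTightClosure

/-!
# Door designs are mixed designs: the link from the door's hypothesis to the typed conjecture HALL-6

The door `algBorderRank_kroneckerPow_cwTensor_two_le_sigma_succ` consumes an integer weighted design in the
Alman–Vassilevska-Williams form `IsDoorDesign F θ` (every digit relation `P(u)+P(v)+P(w) = σ` is transversal or
heavy), while the seat's closure theorems (`onePair_mixedClosure_of_isMixedDesign`, `tight_mixedClosure`,
`mixedClosure_of_hallSixConjecture`) are stated over the Gordan / vertex form `IsMixedDesign s d t`.  This file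
proves that a door design in normal form — digit triples `(0, s_k, d_k)` with `s_k < d_k` — IS a mixed design with
no singletons: the weights `θ` themselves give the Gordan weights `ys k = θ k 1 - θ k 0`, `yd k = θ k 2 - θ k 0`,
because every nonzero allowed zero-relation is the letter-count defect of an explicit non-transversal word triple.
Consequences: D7-CLOSURE `4^N ≤ σ + 1` for normal-form door designs follows from HALL-6
(`doorClosure_of_hallSixConjecture`), and holds outright for all-tight ones (`doorClosure_tight`); the same for door
designs with increasingly ORDERED digit triples, by shifting to normal form (`isDoorDesign_normDigits_of_ordered`,
`doorClosure_of_hallSixConjecture_of_ordered`, `doorClosure_tight_of_ordered` — arithmetic-progression digit triples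
never beat border rank `4^N`).

Written by the solo-informed seat (gen 13); standard axioms only.
-/

namespace Summit.MatrixMultiplication.MatrixMultiplication.Theorems

open Finset

/-- The non-transversal letter triple witnessing an allowed pattern `(a, b)`: its letter counts are
`(1 - a - b, 1 + a, 1 + b)` for the letters `0, s, d`. -/
def patTriple (a b : ℤ) : Fin 3 × Fin 3 × Fin 3 :=
  if a = -1 ∧ b = -1 then (0, 0, 0) else if a = -1 ∧ b = 0 then (0, 0, 2) else if a = 0 ∧ b = -1 then (0, 0, 1)
  else if a = -1 ∧ b = 1 then (0, 2, 2) else if a = 1 ∧ b = -1 then (0, 1, 1) else if a = 0 ∧ b = 0 then (0, 1, 2)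
  else if a = 1 ∧ b = 0 then (1, 1, 2) else if a = 0 ∧ b = 1 then (1, 2, 2) else if a = -1 ∧ b = 2 then (2, 2, 2)
  else (1, 1, 1)

/-- The ten allowed patterns. -/
theorem allowed_cases {a b : ℤ} (h : -1 ≤ a ∧ -1 ≤ b ∧ a + b ≤ 1) :
    (a = -1 ∧ b = -1) ∨ (a = -1 ∧ b = 0) ∨ (a = 0 ∧ b = -1) ∨ (a = -1 ∧ b = 1) ∨ (a = 1 ∧ b = -1) ∨
    (a = 0 ∧ b = 0) ∨ (a = 1 ∧ b = 0) ∨ (a = 0 ∧ b = 1) ∨ (a = -1 ∧ b = 2) ∨ (a = 2 ∧ b = -1) := by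
  omega

/-- Letter-count identity of the witness triple: summing any `g` over its three letters gives the transversal sum
plus the defect `a (g 1 - g 0) + b (g 2 - g 0)`. -/
theorem patTriple_sum {a b : ℤ} (h : -1 ≤ a ∧ -1 ≤ b ∧ a + b ≤ 1) (g : Fin 3 → ℤ) :
    g (patTriple a b).1 + g (patTriple a b).2.1 + g (patTriple a b).2.2 =
      (g 0 + g 1 + g 2) + a * (g 1 - g 0) + b * (g 2 - g 0) := by
  rcases allowed_cases h with ⟨rfl, rfl⟩ | ⟨rfl, rfl⟩ | ⟨rfl, rfl⟩ | ⟨rfl, rfl⟩ | ⟨rfl, rfl⟩ | ⟨rfl, rfl⟩ |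
    ⟨rfl, rfl⟩ | ⟨rfl, rfl⟩ | ⟨rfl, rfl⟩ | ⟨rfl, rfl⟩ <;> simp [patTriple] <;> ring

/-- The witness triple of a nonzero pattern is not transversal. -/
theorem patTriple_not_transversal {a b : ℤ} (h : -1 ≤ a ∧ -1 ≤ b ∧ a + b ≤ 1) (hne : a ≠ 0 ∨ b ≠ 0) :
    ¬ ((patTriple a b).1 ≠ (patTriple a b).2.1 ∧ (patTriple a b).1 ≠ (patTriple a b).2.2 ∧
        (patTriple a b).2.1 ≠ (patTriple a b).2.2) := by
  rcases allowed_cases h with ⟨rfl, rfl⟩ | ⟨rfl, rfl⟩ | ⟨rfl, rfl⟩ | ⟨rfl, rfl⟩ | ⟨rfl, rfl⟩ | ⟨rfl, rfl⟩ |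
    ⟨rfl, rfl⟩ | ⟨rfl, rfl⟩ | ⟨rfl, rfl⟩ | ⟨rfl, rfl⟩ <;> simp_all [patTriple]

/-- The normal-form digit triples `(0, s_k, d_k)` of a pair system, over `ℤ`. -/
def normDigits {N : ℕ} (s d : Fin N → ℕ) : Fin N → Fin 3 → ℤ := fun k => ![0, (s k : ℤ), (d k : ℤ)]

/-- **Door designs in normal form are mixed designs** (no singletons), with Gordan weights read off the door
weights: `ys k = θ k 1 - θ k 0`, `yd k = θ k 2 - θ k 0`. -/
theorem isMixedDesign_of_isDoorDesign {N : ℕ} (s d : Fin N → ℕ) (θ : Fin N → Fin 3 → ℕ)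
    (hsd : ∀ k, s k < d k) (hdes : IsDoorDesign (normDigits s d) θ) :
    IsMixedDesign s d (Fin.elim0 : Fin 0 → ℕ) := by
  refine ⟨hsd, fun k => (θ k 1 : ℤ) - θ k 0, fun k => (θ k 2 : ℤ) - θ k 0, Fin.elim0, ?_⟩
  intro a b c hal hval hne
  -- the singleton parts are empty
  have hc0 : c = Fin.elim0 := funext fun i => i.elim0
  simp only [Finset.univ_eq_empty, Finset.sum_empty, add_zero] at hval ⊢
  have hab : a ≠ 0 ∨ b ≠ 0 := by
    rcases hne with h | h | h
    · exact Or.inl h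
    · exact Or.inr h
    · exact absurd (funext fun i => i.elim0) h
  -- the witness triple, pair by pair
  let u : Fin N → Fin 3 := fun k => (patTriple (a k) (b k)).1
  let v : Fin N → Fin 3 := fun k => (patTriple (a k) (b k)).2.1
  let w : Fin N → Fin 3 := fun k => (patTriple (a k) (b k)).2.2
  have hk : ∀ k, -1 ≤ a k ∧ -1 ≤ b k ∧ a k + b k ≤ 1 := fun k => hal.1 k
  -- its value: the transversal value plus the relation value, which is zero
  have hsum : wordSum (normDigits s d) u + wordSum (normDigits s d) v + wordSum (normDigits s d) w =
      ∑ k, (normDigits s d k 0 + normDigits s d k 1 + normDigits s d k 2) := by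
    simp only [wordSum, ← Finset.sum_add_distrib]
    have step : ∀ k, normDigits s d k (u k) + normDigits s d k (v k) + normDigits s d k (w k) =
        (normDigits s d k 0 + normDigits s d k 1 + normDigits s d k 2) +
          (a k * (s k : ℤ) + b k * (d k : ℤ)) := by
      intro k
      have key := patTriple_sum (hk k) (normDigits s d k)
      simp only [u, v, w]
      rw [key]
      simp only [normDigits, Matrix.cons_val_zero, Matrix.cons_val_one, Matrix.head_cons, Matrix.cons_val_two,
        Matrix.tail_cons]
      ring
    rw [Finset.sum_congr rfl fun k _ => step k, Finset.sum_add_distrib, hval, add_zero]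
  rcases hdes u v w hsum with htr | hwt
  · -- transversal: impossible, some pair carries a nonzero pattern
    exfalso
    have : ∃ k, a k ≠ 0 ∨ b k ≠ 0 := by
      rcases hab with h | h
      · obtain ⟨k, hk'⟩ := Function.ne_iff.mp h; exact ⟨k, Or.inl hk'⟩
      · obtain ⟨k, hk'⟩ := Function.ne_iff.mp h; exact ⟨k, Or.inr hk'⟩
    obtain ⟨k, hk'⟩ := this
    exact patTriple_not_transversal (hk k) hk' (htr k)
  · -- heavy: the weight defect is the Gordan functional, and it is ≥ 1
    have hwt' : ((∑ k, (θ k 0 + θ k 1 + θ k 2) : ℕ) : ℤ) <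
        ((wordWt θ u + wordWt θ v + wordWt θ w : ℕ) : ℤ) := by exact_mod_cast hwt
    have hexp : ((wordWt θ u + wordWt θ v + wordWt θ w : ℕ) : ℤ) =
        ((∑ k, (θ k 0 + θ k 1 + θ k 2) : ℕ) : ℤ) +
          ∑ k, (a k * ((θ k 1 : ℤ) - θ k 0) + b k * ((θ k 2 : ℤ) - θ k 0)) := by
      simp only [wordWt, Nat.cast_sum, Nat.cast_add, ← Finset.sum_add_distrib]
      refine Finset.sum_congr rfl fun k _ => ?_
      have := patTriple_sum (hk k) (fun j => (θ k j : ℤ))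
      simp only [u, v, w] at this ⊢
      linarith
    rw [hexp] at hwt'
    linarith

/-- **D7-closure from HALL-6 at the door**: under HALL-6, every normal-form door design of `N` pairs has
`4^N ≤ σ + 1`, `σ = ∑ (s_k + d_k)` — no monomial degeneration of `T_{cw,2}^{⊠N}` in normal form beats border rank. -/
theorem doorClosure_of_hallSixConjecture (hconj : HallSixConjecture) {N : ℕ} (s d : Fin N → ℕ)
    (θ : Fin N → Fin 3 → ℕ) (hsd : ∀ k, s k < d k) (hdes : IsDoorDesign (normDigits s d) θ) :
    4 ^ N ≤ (∑ k, (s k + d k)) + 1 := by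
  have h := mixedClosure_of_hallSixConjecture hconj s d (Fin.elim0 : Fin 0 → ℕ)
    (isMixedDesign_of_isDoorDesign s d θ hsd hdes)
  simpa [mixedSigma] using h

/-- **Unconditional all-tight case at the door**: a normal-form door design with `d_k = 2 s_k` for every pair has
`4^N ≤ σ + 1`. -/
theorem doorClosure_tight {N : ℕ} (s d : Fin N → ℕ) (θ : Fin N → Fin 3 → ℕ) (hsd : ∀ k, s k < d k)
    (htight : ∀ k, d k = 2 * s k) (hdes : IsDoorDesign (normDigits s d) θ) :
    4 ^ N ≤ (∑ k, (s k + d k)) + 1 := by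
  have h := tight_designClosure s d htight (isMixedDesign_of_isDoorDesign s d θ hsd hdes)
  simpa [mixedSigma] using h

/-! ## Ordered door designs: shift to normal form -/

/-- Shifting every digit triple of an increasingly ordered door design down by its smallest digit gives a door
design in normal form (every relation value and the transversal value shift by the same `3 ∑ₖ F k 0`). -/
theorem isDoorDesign_normDigits_of_ordered {N : ℕ} (F θ : Fin N → Fin 3 → ℕ)
    (hord : ∀ k, F k 0 < F k 1 ∧ F k 1 < F k 2) (hdes : IsDoorDesign (fun k j => (F k j : ℤ)) θ) :
    IsDoorDesign (normDigits (fun k => F k 1 - F k 0) (fun k => F k 2 - F k 0)) θ := by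
  intro u v w hsum
  have hF : ∀ k (j : Fin 3), ((F k j : ℕ) : ℤ) =
      (F k 0 : ℤ) + normDigits (fun k => F k 1 - F k 0) (fun k => F k 2 - F k 0) k j := by
    intro k j
    have h1 : F k 0 ≤ F k 1 := (hord k).1.le
    have h2 : F k 0 ≤ F k 2 := ((hord k).1.trans (hord k).2).le
    fin_cases j <;> simp [normDigits, Nat.cast_sub h1, Nat.cast_sub h2]
  have key : ∀ x : Fin N → Fin 3, wordSum (fun k j => (F k j : ℤ)) x =
      (∑ k, (F k 0 : ℤ)) + wordSum (normDigits (fun k => F k 1 - F k 0) (fun k => F k 2 - F k 0)) x := by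
    intro x
    simp only [wordSum, ← Finset.sum_add_distrib]
    exact Finset.sum_congr rfl fun k _ => hF k (x k)
  have htot : ∑ k, ((F k 0 : ℤ) + (F k 1 : ℤ) + (F k 2 : ℤ)) = 3 * ∑ k, (F k 0 : ℤ) +
      ∑ k, (normDigits (fun k => F k 1 - F k 0) (fun k => F k 2 - F k 0) k 0 +
        normDigits (fun k => F k 1 - F k 0) (fun k => F k 2 - F k 0) k 1 +
        normDigits (fun k => F k 1 - F k 0) (fun k => F k 2 - F k 0) k 2) := by
    rw [Finset.mul_sum, ← Finset.sum_add_distrib]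
    refine Finset.sum_congr rfl fun k _ => ?_
    have h0 : normDigits (fun k => F k 1 - F k 0) (fun k => F k 2 - F k 0) k 0 = 0 := by simp [normDigits]
    rw [hF k 1, hF k 2, h0]
    ring
  refine hdes u v w ?_
  show wordSum (fun k j => (F k j : ℤ)) u + wordSum (fun k j => (F k j : ℤ)) v +
      wordSum (fun k j => (F k j : ℤ)) w = ∑ k, ((F k 0 : ℤ) + (F k 1 : ℤ) + (F k 2 : ℤ))
  rw [key u, key v, key w, htot, ← hsum]
  ring

/-- **D7-closure from HALL-6 for ordered door designs**: under HALL-6 an integer weighted design of the door with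
increasingly ordered digit triples never beats border rank: `4^N ≤ σ + 1`, `σ = digitSigma F`. -/
theorem doorClosure_of_hallSixConjecture_of_ordered (hconj : HallSixConjecture) {N : ℕ} (F θ : Fin N → Fin 3 → ℕ)
    (hord : ∀ k, F k 0 < F k 1 ∧ F k 1 < F k 2) (hdes : IsDoorDesign (fun k j => (F k j : ℤ)) θ) :
    4 ^ N ≤ digitSigma F + 1 := by
  have hsd : ∀ k, F k 1 - F k 0 < F k 2 - F k 0 := fun k => by have := hord k; omega
  have h := doorClosure_of_hallSixConjecture hconj (fun k => F k 1 - F k 0) (fun k => F k 2 - F k 0) θ hsd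
    (isDoorDesign_normDigits_of_ordered F θ hord hdes)
  have hle : ∑ k, ((F k 1 - F k 0) + (F k 2 - F k 0)) ≤ digitSigma F := by
    unfold digitSigma
    exact Finset.sum_le_sum fun k _ => by have := hord k; omega
  omega

/-- **Unconditionally**: an ordered door design all of whose digit triples are tight (`F k 2 - F k 0 = 2 (F k 1 -
F k 0)`, i.e. an arithmetic progression) never beats border rank: `4^N ≤ digitSigma F + 1`. -/
theorem doorClosure_tight_of_ordered {N : ℕ} (F θ : Fin N → Fin 3 → ℕ)
    (hord : ∀ k, F k 0 < F k 1 ∧ F k 1 < F k 2) (htight : ∀ k, F k 2 - F k 0 = 2 * (F k 1 - F k 0))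
    (hdes : IsDoorDesign (fun k j => (F k j : ℤ)) θ) : 4 ^ N ≤ digitSigma F + 1 := by
  have hsd : ∀ k, F k 1 - F k 0 < F k 2 - F k 0 := fun k => by have := hord k; omega
  have h := doorClosure_tight (fun k => F k 1 - F k 0) (fun k => F k 2 - F k 0) θ hsd htight
    (isDoorDesign_normDigits_of_ordered F θ hord hdes)
  have hle : ∑ k, ((F k 1 - F k 0) + (F k 2 - F k 0)) ≤ digitSigma F := by
    unfold digitSigma
    exact Finset.sum_le_sum fun k _ => by have := hord k; omega
  omega

end Summit.MatrixMultiplication.MatrixMultiplication.Theorems
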